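import Summits.Ventures.LatticeQCDFlow.Scaling.DominatedStarAutocorrelationCeiling

/-!
HONEST FRAMING: exact (Metropolis-corrected) sampling algorithms for lattice gauge theory; figures
of merit are autocorrelation/cost numbers at stated couplings and volumes; no continuum-physics
claim.

# DominatedStarCostCeiling — COST ACCOUNTING FOR THE MAP-ASSISTED HOT-REFRESHED HUB: IF A SWAP ATTEMPT (FLOW EVALUATION
# AND ACCEPTANCE TEST) COSTS `κ_s` AND AN UPDATE `κ_u`, THEN UNDER ONE-SIDED DOMINATION `p` AND `4t ≤ p(1−t)w_0` ONE
# RELAXATION TIME COSTS AT MOST `(2m/(cp))·(κ_s + ((1−t)/t)·κ_u)` AND ONE AUTOCORRELATION TIME OF ANY OBSERVABLE AT MOST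
# `(2m/(tcp) − ½)·(tκ_s + (1−t)κ_u)`; FOR THE HOT-ONLY STAR AT `m = cK`, `t = p/(4+p)`: AT MOST `2Kκ_s/p + 8Kκ_u/p²`
# PER AUTOCORRELATION TIME — ORDER `K/p` SWAP TESTS PLUS ORDER `K/p²` EXACT HOT DRAWS (lean-2 GEN-26, ours)

Venture-side (OURS).  Cell `lqcd-flow` (pub-lqcd), unit `pub-lqcd-lean-2-g26`, 2026-08-27.  Chapter M, file 27 — the
chapter in the currency of `Scaling/ExchangeCostLaw` (chapter K, file 5: there the FLOOR "one relaxation costs at least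
`κ_s/a + κ_u/b`").  The mean cost of a step of `P = t·GSw + (1−t)·Π_w^M` is `tκ_s + (1−t)κ_u` (a swap step evaluates
one transport and one acceptance test; an update step runs one single-replica kernel); the cost of a relaxation time
is that times `t_rel`, the cost of an independent-equivalent sample of `g` is that times `2τ_int(g)`.

## What is proved

* **`dominatedStar_relaxationCost_le`** — `(tκ_s + (1−t)κ_u)·t_rel ≤ (2m/(cp))·(κ_s + ((1−t)/t)·κ_u)`.
* **`dominatedStar_autocorrelationCost_le`** (`|S| ≥ 2`) — `τ_int(g)·(tκ_s + (1−t)κ_u) ≤ (1/(tcp/(2m)) − ½)·(tκ_s + (1−t)κ_u)`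
  for every observable `g`.
* **`tunedStar_autocorrelationCost_le`** — hot-only updates, `m = cK`, `t = p/(4+p)`:
  **`τ_int(g)·(tκ_s + (1−t)κ_u) ≤ 2Kκ_s/p + 8Kκ_u/p²`**.

Reading (no numerics implied): with a learned transport of one-sided quality `p`, an effectively independent sample
of any observable of the exact (Metropolis-corrected) tempering hub costs at most order `K/p` transport
evaluations-with-test plus order `K/p²` exact hot draws at uniform listing — the transport's price `κ_s` is paid
linearly in `1/p`, the hot sampler's price quadratically (through the regime `t ≲ p/4`); against chapter K's floor of
order `K` swaps plus `K/γ₀` hot updates per relaxation.  NOT CLAIMED: amortised training costs (a constant added to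
`κ_s` per use under a stated schedule only); parallel execution; that the `1/p²` is necessary; anything measured.
Literature grade (cell rule): OWN COMPOSITION (chapter M + arithmetic); nothing cited as a fact; no new bib keys.
-/

noncomputable section

open Finset Function
open Literature.Probability.MarkovChains

namespace Summit.Ventures.LatticeQCDFlow.Scaling

variable {S : Type*} [Fintype S] [DecidableEq S] {K m : ℕ} {μ : Fin (K + 1) → S → ℝ} {M : Fin (K + 1) → S → S → ℝ}
  {w : Fin (K + 1) → ℝ} {t p : ℝ}

section Cost
variable (κ : Fin m → Fin K) (φ : Fin m → Equiv.Perm S)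

/-- **THE COST OF ONE RELAXATION TIME: `(tκ_s + (1−t)κ_u)·t_rel ≤ (2m/(cp))·(κ_s + ((1−t)/t)·κ_u)`** under one-sided
domination and `4t ≤ p(1−t)w_0` (`0 < t`, `κ_s, κ_u ≥ 0`, reversible cold kernels). [ours] -/
theorem dominatedStar_relaxationCost_le (hm : 1 ≤ m) (ht0 : 0 < t) (ht1 : t ≤ 1) (hw0 : ∀ k, 0 ≤ w k)
    (hw1 : ∑ k, w k = 1) (hμ : ∀ k x, 0 < μ k x) (hμ1 : ∀ k, ∑ u, μ k u = 1) (hM : ∀ k, IsRowStochastic (M k))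
    (hMrev : ∀ k, DetailedBalance (μ k) (M k)) (hM0 : ∀ u v, M 0 u v = μ 0 v) (hp0 : 0 < p) (hp1 : p ≤ 1)
    (hdom : ∀ r u, p * μ (κ r).succ (φ r u) ≤ μ 0 u) (hreg : 4 * t ≤ p * (1 - t) * w 0)
    {c : ℕ} (hc1 : 1 ≤ c) (hc : ∀ p' : Fin K, c ≤ (univ.filter (fun r : Fin m => κ r = p')).card) (hcm : c ≤ m)
    {κs κu : ℝ} (hκs : 0 ≤ κs) (hκu : 0 ≤ κu) :
    (t * κs + (1 - t) * κu) * relaxationTime (fun y z : Fin (K + 1) → S =>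
        t * ptGraphSwap μ (fun r : Fin m => (((0 : Fin (K + 1)), (κ r).succ) : Fin (K + 1) × Fin (K + 1))) φ y z
          + (1 - t) * prodKernel w M y z)
      ≤ 2 * m / (c * p) * (κs + (1 - t) / t * κu) := by
  have hmpos : (0 : ℝ) < m := Nat.cast_pos.mpr (by omega)
  have hcpos : (0 : ℝ) < c := Nat.cast_pos.mpr (by omega)
  have hrel := dominatedStar_relaxationTime_le κ φ hm ht0 ht1 hw0 hw1 hμ hμ1 hM hMrev hM0 hp0 hp1 hdom hreg hc1 hc hcm
  have hcost : 0 ≤ t * κs + (1 - t) * κu := by nlinarith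
  calc (t * κs + (1 - t) * κu) * relaxationTime _ ≤ (t * κs + (1 - t) * κu) * (2 * m / (t * c * p)) :=
        mul_le_mul_of_nonneg_left hrel hcost
    _ = 2 * m / (c * p) * (κs + (1 - t) / t * κu) := by
        field_simp

/-- **THE COST OF ONE AUTOCORRELATION TIME OF ANY OBSERVABLE:** `τ_int(g)·(tκ_s + (1−t)κ_u) ≤ (1/(tcp/(2m)) − ½)·(tκ_s + (1−t)κ_u)`
(`|S| ≥ 2`). [ours] -/
theorem dominatedStar_autocorrelationCost_le [Nontrivial S] (hm : 1 ≤ m) (ht0 : 0 < t) (ht1 : t ≤ 1) (hw0 : ∀ k, 0 ≤ w k)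
    (hw1 : ∑ k, w k = 1) (hμ : ∀ k x, 0 < μ k x) (hμ1 : ∀ k, ∑ u, μ k u = 1) (hM : ∀ k, IsRowStochastic (M k))
    (hMrev : ∀ k, DetailedBalance (μ k) (M k)) (hM0 : ∀ u v, M 0 u v = μ 0 v) (hp0 : 0 < p) (hp1 : p ≤ 1)
    (hdom : ∀ r u, p * μ (κ r).succ (φ r u) ≤ μ 0 u) (hreg : 4 * t ≤ p * (1 - t) * w 0)
    {c : ℕ} (hc1 : 1 ≤ c) (hc : ∀ p' : Fin K, c ≤ (univ.filter (fun r : Fin m => κ r = p')).card) (hcm : c ≤ m)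
    {κs κu : ℝ} (hκs : 0 ≤ κs) (hκu : 0 ≤ κu) (g : (Fin (K + 1) → S) → ℝ) :
    asympVar g (tensorFun μ) (fun y z : Fin (K + 1) → S =>
        t * ptGraphSwap μ (fun r : Fin m => (((0 : Fin (K + 1)), (κ r).succ) : Fin (K + 1) × Fin (K + 1))) φ y z
          + (1 - t) * prodKernel w M y z) / (2 * lawVariance (tensorFun μ) g) * (t * κs + (1 - t) * κu)
      ≤ (1 / (t * c * p / (2 * m)) - 1 / 2) * (t * κs + (1 - t) * κu) := by
  have hcost : 0 ≤ t * κs + (1 - t) * κu := by nlinarith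
  exact mul_le_mul_of_nonneg_right (dominatedStar_tauInt_le κ φ hm ht0 ht1 hw0 hw1 hμ hμ1 hM hMrev hM0 hp0 hp1 hdom hreg
    hc1 hc hcm g) hcost

/-- **THE TUNED HOT-ONLY STAR (`m = cK`, `t = p/(4+p)`): `τ_int(g)·(tκ_s + (1−t)κ_u) ≤ 2Kκ_s/p + 8Kκ_u/p²`** for every
observable `g` (`|S| ≥ 2`, `K ≥ 1`, one-sided domination, exact hot sampler, reversible cold kernels). [ours] -/
theorem tunedStar_autocorrelationCost_le [Nontrivial S] (hK : 1 ≤ K) (hμ : ∀ k x, 0 < μ k x) (hμ1 : ∀ k, ∑ u, μ k u = 1)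
    (hM : ∀ k, IsRowStochastic (M k)) (hMrev : ∀ k, DetailedBalance (μ k) (M k)) (hM0 : ∀ u v, M 0 u v = μ 0 v)
    (hp0 : 0 < p) (hp1 : p ≤ 1) (hdom : ∀ r u, p * μ (κ r).succ (φ r u) ≤ μ 0 u) {c : ℕ} (hc1 : 1 ≤ c)
    (hc : ∀ p' : Fin K, c ≤ (univ.filter (fun r : Fin m => κ r = p')).card) (hmc : m = c * K)
    {κs κu : ℝ} (hκs : 0 ≤ κs) (hκu : 0 ≤ κu) (g : (Fin (K + 1) → S) → ℝ) :
    asympVar g (tensorFun μ) (fun y z : Fin (K + 1) → S =>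
        p / (4 + p) * ptGraphSwap μ (fun r : Fin m => (((0 : Fin (K + 1)), (κ r).succ) : Fin (K + 1) × Fin (K + 1))) φ y z
          + (1 - p / (4 + p)) * prodKernel (fun k : Fin (K + 1) => if k = 0 then (1 : ℝ) else 0) M y z)
        / (2 * lawVariance (tensorFun μ) g) * (p / (4 + p) * κs + (1 - p / (4 + p)) * κu)
      ≤ 2 * K * κs / p + 8 * K * κu / p ^ 2 := by
  have hm : 1 ≤ m := by rw [hmc]; exact Nat.one_le_iff_ne_zero.mpr (Nat.mul_ne_zero (by omega) (by omega))
  have hcm : c ≤ m := by rw [hmc]; exact Nat.le_mul_of_pos_right c (by omega)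
  have hw0 : ∀ k : Fin (K + 1), 0 ≤ (if k = 0 then (1 : ℝ) else 0) := fun k => by split_ifs <;> norm_num
  have hw1 : ∑ k : Fin (K + 1), (if k = 0 then (1 : ℝ) else 0) = 1 := by
    rw [Finset.sum_ite_eq' univ (0 : Fin (K + 1)), if_pos (mem_univ _)]
  have h4p : 0 < 4 + p := by linarith
  have ht0 : 0 < p / (4 + p) := div_pos hp0 h4p
  have ht1 : p / (4 + p) ≤ 1 := by rw [div_le_one h4p]; linarith
  have hreg : 4 * (p / (4 + p)) ≤ p * (1 - p / (4 + p)) * (if (0 : Fin (K + 1)) = 0 then (1 : ℝ) else 0) := by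
    rw [if_pos rfl, mul_one]
    have e : p * (1 - p / (4 + p)) = 4 * (p / (4 + p)) := by field_simp; ring
    rw [e]
  have h := dominatedStar_autocorrelationCost_le κ φ hm ht0 ht1 hw0 hw1 hμ hμ1 hM hMrev hM0 hp0 hp1 hdom hreg hc1 hc hcm
    hκs hκu g
  refine h.trans ?_
  have hcpos : (0 : ℝ) < c := Nat.cast_pos.mpr (by omega)
  have hKpos : (0 : ℝ) < K := Nat.cast_pos.mpr (by omega)
  have hmR : (m : ℝ) = c * K := by rw [hmc, Nat.cast_mul]
  -- `1/(tcp/(2m)) = 2K(4+p)/p²` and `tκ_s + (1−t)κ_u = (pκ_s + 4κ_u)/(4+p)`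
  have e1 : 1 / (p / (4 + p) * c * p / (2 * (m : ℝ))) = 2 * K * (4 + p) / p ^ 2 := by
    rw [hmR]; field_simp
  have e2 : p / (4 + p) * κs + (1 - p / (4 + p)) * κu = (p * κs + 4 * κu) / (4 + p) := by
    field_simp; ring
  rw [e1, e2]
  have hnum : 0 ≤ p * κs + 4 * κu := by positivity
  -- drop the `−½` and simplify `(2K(4+p)/p²)·(pκ_s + 4κ_u)/(4+p) = 2Kκ_s/p + 8Kκ_u/p²`
  calc (2 * K * (4 + p) / p ^ 2 - 1 / 2) * ((p * κs + 4 * κu) / (4 + p))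
      ≤ 2 * K * (4 + p) / p ^ 2 * ((p * κs + 4 * κu) / (4 + p)) := by
        refine mul_le_mul_of_nonneg_right (by linarith) (div_nonneg hnum h4p.le)
    _ = 2 * K * κs / p + 8 * K * κu / p ^ 2 := by
        field_simp
        ring

end Cost

end Summit.Ventures.LatticeQCDFlow.Scaling

end
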